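import Summits.Ventures.PercRepro.DFSWitness
import Summits.Ventures.PercRepro.BKInequality
import Summits.Ventures.PercRepro.Benchmarks

/-!
# Hutchcroft's bound at four marks: `P(abcd) ≤ P(some pair connected)²` (GZ24, inequality (hc))

Gladkov–Zimin (arXiv:2404.08873, proof of Theorem 3.2) use Hutchcroft's inequality
`P(|K_max(Λ)| ≥ 3λ) ≤ P(|K_max(Λ)| ≥ λ)²` (a van den Berg–Kesten consequence) with `Λ = {a, b, c, d}`
and `λ = 4/3`: if `a, b, c, d` lie in one cluster, two edge-disjoint witnesses of «some pair
of marks is connected» exist, so by the BK inequality (`bk`, `BKInequality.lean`)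
`P(abcd) ≤ P(some pair)²` — typer-2's benchmark `GZ24HC43` (`GZ24HC43_holds`).

The two witnesses come from the DFS from `a` stopped at `{b, c, d}` (`DFSTree.lean`): at its
leaf the queried set `S` contains the backtracking path from `a` to the target `u` found, and the
two other marks `c'`, `d'` are unexplored.  Let `ζ` be the configuration open exactly at the
`ω`-open edges off `S` (`offS`).  If `c' ~ d'` in `ζ`, the open edges of the `ζ`-cluster of `c'`
(`clusterEdgeSet`) witness `c' ~ d'` and the path witnesses `a ~ u`, disjointly (on/off `S`).
Otherwise the `ζ`-clusters of `c'` and `d'` are different, hence edge-disjoint, and each reaches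
the stack (`exists_stack_vertex_conn_off`); splitting the path at the deeper entry vertex
(`PathOK.split`, `take_drop_disjoint`) gives the two witnesses as in Gladkov's §6.2.
-/

namespace PercRepro

open Finset

variable {E : Type*}

/-- Two witnesses of consecutive connections combine to a witness of the composite one. -/
theorem witness_union_conn {V : Type*} {G : MultiGraph V E} {x y z : V} {I J : Set E}
    {ω : Config E} (hI : Witness (G.connEvent x y) I ω) (hJ : Witness (G.connEvent y z) J ω) :
    Witness (G.connEvent x z) (I ∪ J) ω := by
  intro ζ hζ
  have h1 : G.Conn ζ x y := hI ζ fun e he => hζ e (Or.inl he)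
  have h2 : G.Conn ζ y z := hJ ζ fun e he => hζ e (Or.inr he)
  exact h1.trans h2

/-- A witness of `x ~ y` is a witness of `y ~ x`. -/
theorem witness_conn_symm {V : Type*} {G : MultiGraph V E} {x y : V} {I : Set E} {ω : Config E}
    (h : Witness (G.connEvent x y) I ω) : Witness (G.connEvent y x) I ω :=
  fun ζ hζ => (h ζ hζ).symm

/-- `offS S ω ≤ ω`. -/
theorem offS_le_self (S : Set E) (ω : Config E) : offS S ω ≤ ω :=
  offS_le fun _ _ h => h

namespace MultiGraph

variable {V : Type*} {G : MultiGraph V E}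

/-- The open edges of the cluster of `x` in `ζ`. -/
def clusterEdgeSet (ζ : Config E) (x : V) : Set E := {e | ζ e = true ∧ G.fst e ∈ G.cluster ζ x}

/-- **The open edges of a cluster witness its connections** in any configuration dominating
`ζ`: if `x ~ y` in `ζ ≤ ω`, then `clusterEdgeSet ζ x` witnesses `x ~ y` in `ω`. -/
theorem witness_of_clusterEdgeSet {ζ ω : Config E} (hζω : ζ ≤ ω) {x y : V}
    (hxy : G.Conn ζ x y) : Witness (G.connEvent x y) (G.clusterEdgeSet ζ x) ω := by
  intro ζ' hζ'
  refine Conn.induction (G := G) (ω := ζ) (u := x) (motive := fun v => G.Conn ζ' x v)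
    (Conn.refl G ζ' x) ?_ hxy
  intro y z hxy' hadj hy
  obtain ⟨e, he, hends⟩ := hadj
  have hxz : G.Conn ζ x z := hxy'.trans (Conn.of_openAdj ⟨e, he, hends⟩)
  have hmem : e ∈ G.clusterEdgeSet ζ x := by
    refine ⟨he, ?_⟩
    rcases hends with ⟨h1, -⟩ | ⟨h1, -⟩
    · rw [h1]; exact hxy'
    · rw [h1]; exact hxz
  have hωe : ω e = true := by
    have := hζω e
    rw [he] at this
    exact Bool.eq_true_of_true_le this
  have hζ'e : ζ' e = true := (hζ' e hmem).trans hωe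
  exact hy.trans (Conn.of_openAdj ⟨e, hζ'e, hends⟩)

/-- Different clusters have disjoint edge sets. -/
theorem clusterEdgeSet_disjoint {ζ : Config E} {x y : V} (h : ¬ G.Conn ζ x y) :
    Disjoint (G.clusterEdgeSet ζ x) (G.clusterEdgeSet ζ y) := by
  rw [Set.disjoint_left]
  intro e hx hy
  exact h (hx.2.trans hy.2.symm)

/-- The cluster edges of `offS S ω` lie off `S`. -/
theorem clusterEdgeSet_offS_subset {S : Set E} {ω : Config E} {x : V} :
    G.clusterEdgeSet (offS S ω) x ⊆ Sᶜ :=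
  fun _ he => (offS_eq_true_iff.mp he.1).1

/-- The path edges of the stack witness `top ~ a` (whatever the stack's shape). -/
theorem PathOK.witness {ω : Config E} {L : List (E × V)} {top a : V} (h : G.PathOK ω L top a) :
    Witness (G.connEvent top a) {e | e ∈ L.map Prod.fst} ω := by
  intro ζ hζ
  refine (PathOK.congr h fun x hx => ?_).conn
  exact hζ x.1 (List.mem_map_of_mem hx)

/-- The first `m` stack edges witness `top ~ v_m`, the rest witness `v_m ~ a`. -/
theorem PathOK.split_witness {ω : Config E} {L : List (E × V)} {top a : V}
    (h : G.PathOK ω L top a) (m : ℕ) (hm : m < (top :: L.map Prod.snd).length) :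
    Witness (G.connEvent top ((top :: L.map Prod.snd)[m])) {e | e ∈ (L.take m).map Prod.fst} ω ∧
      Witness (G.connEvent ((top :: L.map Prod.snd)[m]) a) {e | e ∈ (L.drop m).map Prod.fst} ω := by
  obtain ⟨h1, h2⟩ := h.split m hm
  exact ⟨fun ζ hζ => h1 ζ fun x hx => hζ x.1 (List.mem_map_of_mem hx),
    fun ζ hζ => h2 ζ fun x hx => hζ x.1 (List.mem_map_of_mem hx)⟩

/-- **Two disjoint pair witnesses at a stop leaf.**  With the stack an open path `L` from `u`
down to `a` inside `S`, the popped set fully queried, queried open edges inside the explored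
set, and two unexplored marks `c' ≠ d'` both joined to `a` in `ω`: there are disjoint edge
sets `I`, `J` each witnessing a connection between two distinct vertices of `{a, u, c', d'}`. -/
theorem exists_disjoint_pair_witnesses {S : Set E} {ω : Config E} {u a c' d' : V}
    {L : List (E × V)} {Q : Finset V} (hpath : G.PathOK ω L u a) (hLS : ∀ x ∈ L, x.1 ∈ S)
    (hnd : (L.map Prod.fst).Nodup)
    (hQ : ∀ q ∈ Q, ∀ e, (G.fst e = q ∨ G.snd e = q) → e ∈ S)
    (hopenIn : ∀ e ∈ S, ω e = true → G.fst e ∈ explored u L Q ∧ G.snd e ∈ explored u L Q)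
    (hc : c' ∉ explored u L Q) (hd : d' ∉ explored u L Q) (hua : u ≠ a)
    (hcd : c' ≠ d') (huc : u ≠ c') (hud : u ≠ d') (hac : a ≠ c') (had : a ≠ d')
    (h1 : G.Conn ω c' a) (h2 : G.Conn ω d' a) :
    ∃ I J : Set E, Disjoint I J ∧
      (∃ x y : V, x ≠ y ∧ (x = a ∨ x = u ∨ x = c' ∨ x = d') ∧ (y = a ∨ y = u ∨ y = c' ∨ y = d') ∧
        Witness (G.connEvent x y) I ω) ∧
      (∃ x y : V, x ≠ y ∧ (x = a ∨ x = u ∨ x = c' ∨ x = d') ∧ (y = a ∨ y = u ∨ y = c' ∨ y = d') ∧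
        Witness (G.connEvent x y) J ω) := by
  set ζ := offS S ω with hζ
  have hζω : ζ ≤ ω := offS_le_self S ω
  -- the path edges lie in `S`; cluster edges of `ζ` lie off `S`
  have hpathS : {e | e ∈ L.map Prod.fst} ⊆ S := by
    intro e he
    obtain ⟨x, hx, rfl⟩ := List.mem_map.mp he
    exact hLS x hx
  have hdisjCP : ∀ (x : V) (P : Set E), P ⊆ S → Disjoint (G.clusterEdgeSet ζ x) P := by
    intro x P hP
    rw [Set.disjoint_left]
    intro e he heP
    exact clusterEdgeSet_offS_subset he (hP heP)
  by_cases hcd' : G.Conn ζ c' d'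
  · -- `c' ~ d'` off `S`: the cluster of `c'` and the whole path
    refine ⟨G.clusterEdgeSet ζ c', {e | e ∈ L.map Prod.fst}, hdisjCP c' _ hpathS,
      ⟨c', d', hcd, Or.inr (Or.inr (Or.inl rfl)), Or.inr (Or.inr (Or.inr rfl)),
        witness_of_clusterEdgeSet hζω hcd'⟩,
      ⟨u, a, hua, Or.inr (Or.inl rfl), Or.inl rfl, hpath.witness⟩⟩
  · -- different clusters: each reaches the stack; split at the deeper entry
    have h1' : G.Conn (mix S ω ω) c' a := by rw [mix_self]; exact h1
    have h2' : G.Conn (mix S ω ω) d' a := by rw [mix_self]; exact h2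
    obtain ⟨x₁, hx₁, hc₁⟩ := exists_stack_vertex_conn_off hpath hQ hopenIn hc h1'
    obtain ⟨x₂, hx₂, hc₂⟩ := exists_stack_vertex_conn_off hpath hQ hopenIn hd h2'
    obtain ⟨m₁, hm₁, rfl⟩ := List.mem_iff_getElem.mp hx₁
    obtain ⟨m₂, hm₂, rfl⟩ := List.mem_iff_getElem.mp hx₂
    obtain ⟨htake₁, hdrop₁⟩ := hpath.split_witness m₁ hm₁
    obtain ⟨htake₂, hdrop₂⟩ := hpath.split_witness m₂ hm₂
    have hwc : Witness (G.connEvent c' ((u :: L.map Prod.snd)[m₁])) (G.clusterEdgeSet ζ c') ω :=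
      witness_of_clusterEdgeSet hζω hc₁
    have hwd : Witness (G.connEvent d' ((u :: L.map Prod.snd)[m₂])) (G.clusterEdgeSet ζ d') ω :=
      witness_of_clusterEdgeSet hζω hc₂
    have hCD : Disjoint (G.clusterEdgeSet ζ c') (G.clusterEdgeSet ζ d') := clusterEdgeSet_disjoint hcd'
    have htakeS : ∀ m, {e | e ∈ (L.take m).map Prod.fst} ⊆ S := fun m e he =>
      hpathS (by
        obtain ⟨x, hx, rfl⟩ := List.mem_map.mp he
        exact List.mem_map_of_mem (List.take_subset _ _ hx))
    have hdropS : ∀ m, {e | e ∈ (L.drop m).map Prod.fst} ⊆ S := fun m e he =>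
      hpathS (by
        obtain ⟨x, hx, rfl⟩ := List.mem_map.mp he
        exact List.mem_map_of_mem (List.drop_subset _ _ hx))
    by_cases hmm : m₂ ≤ m₁
    · -- `I = C(c') ∪ drop m₁` witnesses `c' ~ a`, `J = C(d') ∪ take m₂` witnesses `d' ~ u`
      refine ⟨G.clusterEdgeSet ζ c' ∪ {e | e ∈ (L.drop m₁).map Prod.fst},
        G.clusterEdgeSet ζ d' ∪ {e | e ∈ (L.take m₂).map Prod.fst}, ?_,
        ⟨c', a, hac.symm, Or.inr (Or.inr (Or.inl rfl)), Or.inl rfl, witness_union_conn hwc hdrop₁⟩,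
        ⟨d', u, hud.symm, Or.inr (Or.inr (Or.inr rfl)), Or.inr (Or.inl rfl),
          witness_union_conn hwd (witness_conn_symm htake₂)⟩⟩
      rw [Set.disjoint_union_left]
      refine ⟨Set.disjoint_union_right.mpr ⟨hCD, hdisjCP c' _ (htakeS m₂)⟩, ?_⟩
      refine Set.disjoint_union_right.mpr ⟨(hdisjCP d' _ (hdropS m₁)).symm, ?_⟩
      rw [Set.disjoint_left]
      intro e h1e h2e
      exact take_drop_disjoint hnd hmm h2e h1e
    · -- `I = C(c') ∪ take m₁` witnesses `c' ~ u`, `J = C(d') ∪ drop m₂` witnesses `d' ~ a`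
      have hmm' : m₁ ≤ m₂ := le_of_lt (not_le.mp hmm)
      refine ⟨G.clusterEdgeSet ζ c' ∪ {e | e ∈ (L.take m₁).map Prod.fst},
        G.clusterEdgeSet ζ d' ∪ {e | e ∈ (L.drop m₂).map Prod.fst}, ?_,
        ⟨c', u, huc.symm, Or.inr (Or.inr (Or.inl rfl)), Or.inr (Or.inl rfl),
          witness_union_conn hwc (witness_conn_symm htake₁)⟩,
        ⟨d', a, had.symm, Or.inr (Or.inr (Or.inr rfl)), Or.inl rfl, witness_union_conn hwd hdrop₂⟩⟩
      rw [Set.disjoint_union_left]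
      refine ⟨Set.disjoint_union_right.mpr ⟨hCD, hdisjCP c' _ (hdropS m₂)⟩, ?_⟩
      refine Set.disjoint_union_right.mpr ⟨(hdisjCP d' _ (htakeS m₁)).symm, ?_⟩
      rw [Set.disjoint_left]
      intro e h1e h2e
      exact take_drop_disjoint hnd hmm' h1e h2e

/-- The event «some two of the four marks are connected». -/
def pairEvent4 (m : Fin 4 → V) : Set (Config E) :=
  {ω | ∃ i j : Fin 4, i ≠ j ∧ G.Conn ω (m i) (m j)}

/-- `pairEvent4` is increasing. -/
theorem isUpperSet_pairEvent4 (m : Fin 4 → V) : IsUpperSet (G.pairEvent4 m) :=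
  fun _ _ h ⟨i, j, hij, hc⟩ => ⟨i, j, hij, hc.mono h⟩

/-- `pairEvent4` is the complement of «all four separated». -/
theorem pairEvent4_eq_compl (m : Fin 4 → V) :
    G.pairEvent4 m = (G.partitionEvent m ![0, 1, 2, 3])ᶜ := by
  ext ω
  simp only [pairEvent4, Set.mem_setOf_eq, Set.mem_compl_iff, partitionEvent, not_forall]
  have hinj : ∀ i j : Fin 4, (![0, 1, 2, 3] : Fin 4 → ℕ) i = ![0, 1, 2, 3] j → i = j := by decide
  constructor
  · rintro ⟨i, j, hij, hc⟩
    refine ⟨i, j, fun h => ?_⟩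
    exact hij (hinj i j (h.mp hc))
  · rintro ⟨i, j, h⟩
    by_cases hij : i = j
    · subst hij
      exact absurd ⟨fun _ => rfl, fun _ => Conn.refl G ω (m i)⟩ h
    · refine ⟨i, j, hij, ?_⟩
      by_contra hc
      apply h
      constructor
      · intro hc'; exact absurd hc' hc
      · intro heq; exact absurd (hinj i j heq) hij

/-- A connection between two distinct marks lies in `pairEvent4`. -/
theorem connEvent_subset_pairEvent4 (m : Fin 4 → V) {x y : V} (hxy : x ≠ y)
    (hx : ∃ i, m i = x) (hy : ∃ j, m j = y) : G.connEvent x y ⊆ G.pairEvent4 m := by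
  intro ω hω
  obtain ⟨i, rfl⟩ := hx
  obtain ⟨j, rfl⟩ := hy
  exact ⟨i, j, fun h => hxy (h ▸ rfl), hω⟩

/-- The DFS cannot exhaust the cluster of `a` when `a` is joined to a target. -/
theorem leafState_ne_none_of_mem {T : Finset V} {a t : V} {ω : Config E} {S : Set E}
    {r : Option V} (hleaf : G.LeafState T a ω S r) (ht : t ∈ T) (hat : G.Conn ω a t) :
    r ≠ none := by
  rcases hleaf with ⟨_, _, _, _, u, hr, -⟩ | ⟨hr, Q, haQ, hQ, hopenIn, hnoT⟩
  · rw [hr]; exact Option.some_ne_none u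
  · exfalso
    have hX : ∀ e, ω e = true → (G.fst e ∈ (Q : Set V) ↔ G.snd e ∈ (Q : Set V)) := by
      intro e hopen
      by_cases heS : e ∈ S
      · have := hopenIn e heS hopen
        exact ⟨fun _ => this.2, fun _ => this.1⟩
      · constructor
        · intro h; exact absurd (hQ _ h e (Or.inl rfl)) heS
        · intro h; exact absurd (hQ _ h e (Or.inr rfl)) heS
    exact hnoT t ht (mem_of_conn_of_closed_boundary hX haQ hat)

variable [Fintype E] [DecidableEq E]

/-- **Four connected marks give two disjoint pair witnesses**: `abcd ⊆ pair □ pair`. -/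
theorem abcd_subset_disjointOccurrence [DecidableEq V] {a b c d : V} (hab : a ≠ b) (hac : a ≠ c)
    (had : a ≠ d) (hbc : b ≠ c) (hbd : b ≠ d) (hcd : c ≠ d) {ω : Config E}
    (hωb : G.Conn ω a b) (hωc : G.Conn ω a c) (hωd : G.Conn ω a d) :
    ω ∈ DisjointOccurrence (G.pairEvent4 ![a, b, c, d]) (G.pairEvent4 ![a, b, c, d]) := by
  set T : Finset V := {b, c, d} with hT
  have haT : a ∉ T := by simp [hT, hab, hac, had]
  have hgood := dfs_good_univ (G := G) (a := a) T haT
  have hleaf := hgood.2.2 ω ω fun e he => absurd he (Set.notMem_empty e)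
  rw [Set.empty_union] at hleaf
  obtain ⟨u, hu⟩ := Option.ne_none_iff_exists'.mp
    (leafState_ne_none_of_mem hleaf (by simp [hT]) hωb)
  rw [hu] at hleaf
  rcases hleaf with ⟨top, L, Q, e, u', hr, huT, heS, hωe, hends, henotL, hpath, hLS, hnd, hQ,
      hopenIn, hnoT⟩ | ⟨hr, -⟩
  swap
  · exact absurd hr (Option.some_ne_none u)
  have huu : u = u' := Option.some_injective _ hr
  subst huu
  -- the extended stack
  generalize hS : DTree.run (G.dfs T Finset.univ a [] ∅) ω ω = S at heS hLS hQ hopenIn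
  have hpathx : G.PathOK ω ((e, top) :: L) u a := by
    refine ⟨hωe, ?_, hpath⟩
    rcases hends with ⟨h1', h2'⟩ | ⟨h1', h2'⟩
    · exact Or.inr ⟨h1', h2'⟩
    · exact Or.inl ⟨h1', h2'⟩
  have hLSx : ∀ x ∈ (e, top) :: L, x.1 ∈ S := by
    intro x hx
    rcases List.mem_cons.mp hx with rfl | hx
    · exact heS
    · exact hLS x hx
  have hndx : (((e, top) :: L).map Prod.fst).Nodup := by
    rw [List.map_cons, List.nodup_cons]; exact ⟨henotL, hnd⟩
  have hexpl : ∀ x, x ∈ explored top L Q → x ∈ explored u ((e, top) :: L) Q := by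
    intro x hx
    rw [mem_explored] at hx ⊢
    rw [List.map_cons, List.mem_cons]
    tauto
  have hopenInx : ∀ e' ∈ S, ω e' = true →
      G.fst e' ∈ explored u ((e, top) :: L) Q ∧ G.snd e' ∈ explored u ((e, top) :: L) Q := by
    intro e' he' hopen
    by_cases hee : e' = e
    · rw [hee]
      rcases hends with ⟨h1', h2'⟩ | ⟨h1', h2'⟩
      · exact ⟨hexpl _ (h1' ▸ Or.inl rfl), by rw [h2']; exact Or.inl rfl⟩
      · exact ⟨by rw [h1']; exact Or.inl rfl, hexpl _ (h2' ▸ Or.inl rfl)⟩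
    · have := hopenIn e' he' hee hopen
      exact ⟨hexpl _ this.1, hexpl _ this.2⟩
  have hnotx : ∀ t, t ∈ T → t ≠ u → t ∉ explored u ((e, top) :: L) Q := by
    intro t ht htu hmem
    rw [mem_explored, List.map_cons, List.mem_cons] at hmem
    simp only at hmem
    rcases hmem with h | (h | h) | h
    · exact htu h
    · exact hnoT t ht (Or.inl h)
    · exact hnoT t ht (Or.inr (Or.inl h))
    · exact hnoT t ht (Or.inr (Or.inr h))
  have hua : u ≠ a := fun h => haT (h ▸ huT)
  -- the marks as entries of `![a, b, c, d]`
  have hm : ∀ x, (x = a ∨ x = b ∨ x = c ∨ x = d) → ∃ i : Fin 4, (![a, b, c, d] : Fin 4 → V) i = x := by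
    intro x hx
    rcases hx with rfl | rfl | rfl | rfl
    · exact ⟨0, rfl⟩
    · exact ⟨1, rfl⟩
    · exact ⟨2, rfl⟩
    · exact ⟨3, rfl⟩
  -- the core, for the companions `c'`, `d'` of the target `u`
  have core : ∀ c' d' : V, c' ∈ T → d' ∈ T → c' ≠ u → d' ≠ u → c' ≠ d' → G.Conn ω a c' →
      G.Conn ω a d' → (u = b ∨ u = c ∨ u = d) → (c' = b ∨ c' = c ∨ c' = d) →
      (d' = b ∨ d' = c ∨ d' = d) →
      ω ∈ DisjointOccurrence (G.pairEvent4 ![a, b, c, d]) (G.pairEvent4 ![a, b, c, d]) := by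
    intro c' d' hc'T hd'T hc'u hd'u hc'd' hac' had' hum hc'm hd'm
    have hac'' : a ≠ c' := fun h => haT (h ▸ hc'T)
    have had'' : a ≠ d' := fun h => haT (h ▸ hd'T)
    obtain ⟨I, J, hIJ, ⟨x, y, hxy, hx, hy, hI⟩, ⟨x', y', hxy', hx', hy', hJ⟩⟩ :=
      exists_disjoint_pair_witnesses hpathx hLSx hndx hQ hopenInx
        (hnotx c' hc'T hc'u) (hnotx d' hd'T hd'u) hua hc'd' (Ne.symm hc'u) (Ne.symm hd'u)
        hac'' had'' hac'.symm had'.symm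
    have hmark : ∀ z, (z = a ∨ z = u ∨ z = c' ∨ z = d') → (z = a ∨ z = b ∨ z = c ∨ z = d) := by
      intro z hz
      rcases hz with rfl | rfl | rfl | rfl
      · exact Or.inl rfl
      · exact Or.inr hum
      · exact Or.inr hc'm
      · exact Or.inr hd'm
    refine ⟨I, J, witness_subset ?_ hI, witness_subset ?_ hJ, hIJ⟩
    · exact connEvent_subset_pairEvent4 _ hxy (hm x (hmark x hx)) (hm y (hmark y hy))
    · exact connEvent_subset_pairEvent4 _ hxy' (hm x' (hmark x' hx')) (hm y' (hmark y' hy'))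
  have hbT : b ∈ T := by simp [hT]
  have hcT : c ∈ T := by simp [hT]
  have hdT : d ∈ T := by simp [hT]
  rcases Finset.mem_insert.mp huT with rfl | hu'
  · exact core c d hcT hdT hbc.symm hbd.symm hcd hωc hωd (Or.inl rfl) (Or.inr (Or.inl rfl))
      (Or.inr (Or.inr rfl))
  rcases Finset.mem_insert.mp hu' with rfl | hu''
  · exact core b d hbT hdT hbc hcd.symm hbd hωb hωd (Or.inr (Or.inl rfl)) (Or.inl rfl)
      (Or.inr (Or.inr rfl))
  · have hud : u = d := Finset.mem_singleton.mp hu''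
    subst hud
    exact core b c hbT hcT hbd hcd hbc hωb hωc (Or.inr (Or.inr rfl)) (Or.inl rfl)
      (Or.inr (Or.inl rfl))

/-- **Hutchcroft's bound at four marks**: `P(abcd) ≤ P(some pair connected)²`. -/
theorem hc43 [DecidableEq V] {p : E → ℝ} (hp : IsProb p) {a b c d : V} (hab : a ≠ b)
    (hac : a ≠ c) (had : a ≠ d) (hbc : b ≠ c) (hbd : b ≠ d) (hcd : c ≠ d) :
    prob p (G.partitionEvent ![a, b, c, d] ![0, 0, 0, 0]) ≤
      prob p (G.pairEvent4 ![a, b, c, d]) ^ 2 := by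
  have hsub : G.partitionEvent ![a, b, c, d] ![0, 0, 0, 0] ⊆
      DisjointOccurrence (G.pairEvent4 ![a, b, c, d]) (G.pairEvent4 ![a, b, c, d]) := by
    intro ω hω
    have hωb : G.Conn ω a b := (hω 0 1).mpr rfl
    have hωc : G.Conn ω a c := (hω 0 2).mpr rfl
    have hωd : G.Conn ω a d := (hω 0 3).mpr rfl
    exact abcd_subset_disjointOccurrence hab hac had hbc hbd hcd hωb hωc hωd
  calc prob p (G.partitionEvent ![a, b, c, d] ![0, 0, 0, 0])
      ≤ prob p (DisjointOccurrence (G.pairEvent4 ![a, b, c, d]) (G.pairEvent4 ![a, b, c, d])) :=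
        prob_mono hp hsub
    _ ≤ prob p (G.pairEvent4 ![a, b, c, d]) * prob p (G.pairEvent4 ![a, b, c, d]) :=
        bk hp (isUpperSet_pairEvent4 _) (isUpperSet_pairEvent4 _)
    _ = prob p (G.pairEvent4 ![a, b, c, d]) ^ 2 := by ring

end MultiGraph

/-- **`GZ24HC43` is a theorem**: `P(abcd) ≤ (1 − P(a|b|c|d))²` for every four distinct marks
(typer-2's benchmark row HC43). -/
theorem GZ24HC43_holds : GZ24HC43 := by
  intro V E _ _ G p hp a b c d hn
  classical
  have hab : a ≠ b := by simp_all [List.nodup_cons]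
  have hac : a ≠ c := by simp_all [List.nodup_cons]
  have had : a ≠ d := by simp_all [List.nodup_cons]
  have hbc : b ≠ c := by simp_all [List.nodup_cons]
  have hbd : b ≠ d := by simp_all [List.nodup_cons]
  have hcd : c ≠ d := by simp_all [List.nodup_cons]
  have h := G.hc43 hp hab hac had hbc hbd hcd
  have hcompl : prob p (G.pairEvent4 ![a, b, c, d]) = 1 - G.law4 p a b c d 14 := by
    rw [MultiGraph.pairEvent4_eq_compl, prob_compl]; rfl
  rw [hcompl] at h
  exact h

end PercRepro
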